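import Literature.Barriers.RiemannHypothesis.EpsteinZetaRealZerosDHEvenClassNumber
import Literature.NumberTheory.QuadraticFields.DedekindZetaReducedForms
import Literature.NumberTheory.QuadraticFields.FundamentalDiscriminant
import Literature.NumberTheory.QuadraticFields.IdealClassInverse
import HarnessLib

/-!
# Davenport–Heilbronn for Epstein zeta functions, VII: from integral forms to imaginary quadratic
# fields, and Theorem 3 of Davenport–Heilbronn I for forms (`h(d)` even)

Sibling of `Literature/Barriers/RiemannHypothesis/EpsteinZetaRealZeros.lean` (named fact
`DavenportHeilbronn1936b_epstein`). Everything in this file is PROVED; no definitions, no named facts.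

The hypotheses of `DavenportHeilbronn1936b_epstein` are on an integral form `Q = (a, b, c)`:
positive definite, `d = b² − 4ac` a fundamental discriminant, and "`h(d) > 1`" in the form
`TwoFormClasses d` (two positive definite forms of discriminant `d` which are not properly
equivalent). Davenport–Heilbronn I §4 passes to the field: "It is well known that the various
non-equivalent quadratic forms of discriminant `d` correspond (1, 1) to the classes `𝔎` of ideals in
the quadratic field `P(√d)`". This file supplies that passage from the tree's dictionary
(`QuadraticFields/FundamentalDiscriminant.lean`: every fundamental `d` is `d_K` of a quadratic
field; `QuadraticFields/DedekindZetaReducedForms.lean`: `reducedForms d_K ≃ Cl(K)`, Cox Thm. 7.7;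
`QuadraticFields/BinaryQuadraticFormsClassNumber.lean`: reduction theory, Cox Thm. 2.8):

* `isPrimitive_of_isFundamentalDiscriminant` — every form of fundamental discriminant is primitive;
* `exists_ne_mem_reducedForms_of_twoFormClasses` — `TwoFormClasses d` gives two distinct reduced
  forms of discriminant `d`, whence `h(d) ≥ 2` (and `d < −4` by the tree's
  `Quadratic.lt_neg_four_of_twoFormClasses`, `IdealClassInverse.lean`);
* `exists_fieldData` — for `(a, b, c)` as in the fact: an imaginary quadratic field `K` with
  `d_K = d = t² + 4m < −4`, integral basis `(1, ω)`, `ω² = m + tω`, an integer `k` with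
  `b = 2k − t`, `ac = k² − tk − m` (so `(a, ω − k)` is the lattice ideal of `(a, −b, c)`), and
  `2 ≤ h_K = h(d)`;
* `davenportHeilbronn_epstein_of_even_classNumber` — **Davenport–Heilbronn I, Theorem 3** (with
  Titchmarsh's count): the conclusion of `DavenportHeilbronn1936b_epstein` for every `(a, b, c)`
  satisfying its hypotheses whose form class number `h(b² − 4ac)` is EVEN
  (`davenportHeilbronn_conclusion_of_even_card` and `Z_{(a,−b,c)} = Z_{(a,b,c)}`).

## References

* [DavenportHeilbronn1936a] H. Davenport, H. Heilbronn, *On the zeros of certain Dirichlet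
  series I*, J. London Math. Soc. 11 (1936), 181–185, §4, Theorem 3.
* [Cox2013] D. A. Cox, *Primes of the form x² + ny²*, 2nd ed. (2013), Thm. 2.8, §7.B Thm. 7.7.
* [Titchmarsh1986] E. C. Titchmarsh, *The Theory of the Riemann Zeta-Function*, 2nd ed., §10.25.
-/

noncomputable section

open Filter Topology Complex NumberField IsDedekindDomain Module Set
open Literature.NumberTheory.QuadraticFields Literature.NumberTheory.QuadraticFields.Quadratic
open Literature.NumberTheory.QuadraticFields.BinaryQuadraticForm (reducedForms mem_reducedForms_iff
  isReduced_iff discr_apply le_of_isReduced discr_emod_four)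
open Literature.NumberTheory.EllipticCurves (two_mul_ediv_two_of_disc_eq norm_eq_of_disc_eq)
open scoped nonZeroDivisors Classical

namespace Literature.Barriers.RiemannHypothesis

namespace DHEpstein

/-! ## Forms of fundamental discriminant -/

/-- **Every form of fundamental discriminant is primitive**: a common divisor `g` of `a, b, c` has
`g² ∣ d`, so `g² ∈ {1, 4}` (`sq_eq_one_or_four_of_sq_dvd`); `g = 2` would give `4 ∣ d` and
`d/4 = (b/2)² − 4(a/2)(c/2) ≡ 0, 1 (mod 4)`, not `2, 3`. [folklore] -/
theorem isPrimitive_of_isFundamentalDiscriminant {d : ℤ} (hd : IsFundamentalDiscriminant d)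
    {Q : ℤ × ℤ × ℤ} (hQ : formDisc Q = d) : BinaryQuadraticForm.IsPrimitive Q := by
  obtain ⟨a, b, c⟩ := Q
  simp only [formDisc] at hQ
  unfold BinaryQuadraticForm.IsPrimitive
  simp only
  set g : ℕ := Int.gcd (Int.gcd a b) c with hg
  have hga : (g : ℤ) ∣ a := (Int.gcd_dvd_left ..).trans (Int.gcd_dvd_left ..)
  have hgb : (g : ℤ) ∣ b := (Int.gcd_dvd_left ..).trans (Int.gcd_dvd_right ..)
  have hgc : (g : ℤ) ∣ c := Int.gcd_dvd_right ..
  have hsq : (g : ℤ) ^ 2 ∣ d := by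
    obtain ⟨a', ha'⟩ := hga
    obtain ⟨b', hb'⟩ := hgb
    obtain ⟨c', hc'⟩ := hgc
    exact ⟨b' ^ 2 - 4 * a' * c', by rw [← hQ, ha', hb', hc']; ring⟩
  rcases Quadratic.sq_eq_one_or_four_of_sq_dvd hd hsq with h1 | h4
  · have : (g : ℤ) = 1 := by
      have h0 : (0 : ℤ) ≤ g := Int.natCast_nonneg g
      nlinarith
    exact_mod_cast this
  · exfalso
    have h2 : (g : ℤ) = 2 := by
      have h0 : (0 : ℤ) ≤ g := Int.natCast_nonneg g
      nlinarith
    rw [h2] at hga hgb hgc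
    obtain ⟨a', rfl⟩ := hga
    obtain ⟨b', rfl⟩ := hgb
    obtain ⟨c', rfl⟩ := hgc
    have hd4 : d = 4 * (b' ^ 2 - 4 * a' * c') := by rw [← hQ]; ring
    have hmod := discr_emod_four (a', b', c')
    rw [discr_apply] at hmod
    rcases hd with ⟨h1, -, -⟩ | ⟨-, hm, -⟩
    · omega
    · rw [hd4, Int.mul_ediv_cancel_left _ four_ne_zero] at hm
      omega

/-- The tree's proper equivalence of `BinQF`s is the fact's `ProperlyEquivalent` on coefficient
triples (same printed formulas). [folklore] -/
theorem properlyEquivalent_of_properEquiv {Q₁ Q₂ : ℤ × ℤ × ℤ}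
    (h : (BinQF.mk Q₁.1 Q₁.2.1 Q₁.2.2).ProperEquiv (BinQF.mk Q₂.1 Q₂.2.1 Q₂.2.2)) :
    ProperlyEquivalent Q₁ Q₂ := by
  obtain ⟨p, q, r, s, hdet, heq⟩ := h
  simp only [BinQF.act, BinQF.mk.injEq] at heq
  obtain ⟨h1, h2, h3⟩ := heq
  exact ⟨p, q, r, s, hdet, h1, h2, h3⟩

/-- **`TwoFormClasses d` gives two distinct reduced forms of discriminant `d`** (`d < 0`
fundamental): reduce both forms (Cox Thm. 2.8, `BinQF.exists_properEquiv_isReduced`); equal reduced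
forms would make the original forms properly equivalent. [cite: Cox2013, Thm. 2.8] -/
theorem exists_ne_mem_reducedForms_of_twoFormClasses {d : ℤ} (hd : IsFundamentalDiscriminant d)
    (hneg : d < 0) (h2 : TwoFormClasses d) :
    ∃ R₁ ∈ reducedForms d, ∃ R₂ ∈ reducedForms d, R₁ ≠ R₂ := by
  obtain ⟨Q₁, Q₂, hA₁, hA₂, hd₁, hd₂, hne⟩ := h2
  set f₁ : BinQF := ⟨Q₁.1, Q₁.2.1, Q₁.2.2⟩ with hf₁
  set f₂ : BinQF := ⟨Q₂.1, Q₂.2.1, Q₂.2.2⟩ with hf₂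
  have hp₁ : f₁.IsPosPrim d := ⟨hd₁, hA₁, isPrimitive_of_isFundamentalDiscriminant hd hd₁⟩
  have hp₂ : f₂.IsPosPrim d := ⟨hd₂, hA₂, isPrimitive_of_isFundamentalDiscriminant hd hd₂⟩
  obtain ⟨g₁, hfg₁, hred₁⟩ := BinQF.exists_properEquiv_isReduced hneg hp₁
  obtain ⟨g₂, hfg₂, hred₂⟩ := BinQF.exists_properEquiv_isReduced hneg hp₂
  have hg₁ : g₁.IsPosPrim d := hfg₁.isPosPrim hneg hp₁
  have hg₂ : g₂.IsPosPrim d := hfg₂.isPosPrim hneg hp₂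
  refine ⟨(g₁.a, g₁.b, g₁.c), ?_, (g₂.a, g₂.b, g₂.c), ?_, ?_⟩
  · rw [mem_reducedForms_iff hneg]
    exact ⟨hg₁.disc_eq, hg₁.a_pos, hg₁.primitive, (isReduced_iff g₁.a g₁.b g₁.c).2 hred₁⟩
  · rw [mem_reducedForms_iff hneg]
    exact ⟨hg₂.disc_eq, hg₂.a_pos, hg₂.primitive, (isReduced_iff g₂.a g₂.b g₂.c).2 hred₂⟩
  · intro heq
    simp only [Prod.mk.injEq] at heq
    have hg : g₁ = g₂ := by
      cases g₁; cases g₂; simp only [BinQF.mk.injEq]; exact heq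
    apply hne
    apply properlyEquivalent_of_properEquiv
    rw [← hf₁, ← hf₂]
    exact hfg₁.trans (hg ▸ hfg₂.symm)

/-- **`TwoFormClasses d` gives `2 ≤ h(d)`** (two distinct reduced forms). [cite: Cox2013, Thm. 2.8] -/
theorem two_le_card_reducedForms_of_twoFormClasses {d : ℤ} (hd : IsFundamentalDiscriminant d)
    (hneg : d < 0) (h2 : TwoFormClasses d) : 2 ≤ (reducedForms d).card := by
  obtain ⟨R₁, h₁, R₂, h₂, hne⟩ := exists_ne_mem_reducedForms_of_twoFormClasses hd hneg h2
  exact Finset.one_lt_card.2 ⟨R₁, h₁, R₂, h₂, hne⟩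

/-! ## The field data of a form -/

/-- **From the fact's form to the field** (D–H I §4: "the various non-equivalent quadratic forms
of discriminant `d` correspond (1, 1) to the classes of ideals in the quadratic field `P(√d)`").
For integers `a, b, c` with `(a, b, c)` positive definite, `d = b² − 4ac` fundamental and
`TwoFormClasses d`: there are an imaginary quadratic field `K` (`[K:ℚ] = 2`) with integral basis
`(1, ω)`, `ω² = m + tω`, `d_K = t² + 4m = d < −4`, an integer `k` with `t − 2k = −b` and
`ac = k² − tk − m` (so `(a, ω − k)` is the lattice ideal of the form `(a, −b, c)`), and
`2 ≤ h_K = h(d)` (the number of reduced forms of discriminant `d`). Ingredients: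
`exists_numberField_discr_eq`, `exists_basis_zero_eq_one`, `discr_eq_sq_add_four_mul`,
`card_reducedForms_eq_classNumber'` (Cox Thm. 7.7). [cite: Cox2013, §7.B Thm. 7.7] -/
theorem exists_fieldData (a b c : ℤ) (hQ : IsPosDefForm a b c)
    (hd : IsFundamentalDiscriminant (b ^ 2 - 4 * a * c)) (h2f : TwoFormClasses (b ^ 2 - 4 * a * c)) :
    ∃ (K : Type) (_ : Field K) (_ : NumberField K) (bK : Basis (Fin 2) ℤ (𝓞 K)) (t m k : ℤ),
      finrank ℚ K = 2 ∧ bK 0 = 1 ∧ bK 1 * bK 1 = (m : 𝓞 K) + (t : 𝓞 K) * bK 1 ∧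
      t ^ 2 + 4 * m < -4 ∧ 0 < a ∧ a * c = k ^ 2 - t * k - m ∧ t - 2 * k = -b ∧
      2 ≤ Nat.card (ClassGroup (𝓞 K)) ∧
      (reducedForms (b ^ 2 - 4 * a * c)).card = Nat.card (ClassGroup (𝓞 K)) := by
  set d : ℤ := b ^ 2 - 4 * a * c with hdd
  have hneg : d < 0 := by
    have h := hQ.disc_neg
    exact_mod_cast h
  have ha : 0 < a := by
    have h := hQ.a_pos
    exact_mod_cast h
  obtain ⟨K, _, _, h2, hdisc⟩ := exists_numberField_discr_eq hd
  obtain ⟨bK, hb⟩ := exists_basis_zero_eq_one h2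
  have hω := basis_one_mul_self_eq bK hb
  have hdK := discr_eq_sq_add_four_mul bK hb
  set m : ℤ := bK.repr (bK 1 * bK 1) 0 with hm
  set t : ℤ := bK.repr (bK 1 * bK 1) 1 with ht
  have hdt : d = t ^ 2 + 4 * m := by rw [← hdisc, hdK]
  have hlt : d < -4 := Quadratic.lt_neg_four_of_twoFormClasses hd hneg h2f
  have hneg' : t ^ 2 + 4 * m < 0 := by rw [← hdt]; exact hneg
  have hdisc' : b ^ 2 - 4 * a * c = t ^ 2 + 4 * m := hdt
  set k : ℤ := (b + t) / 2 with hk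
  have h2k : 2 * k = b + t := two_mul_ediv_two_of_disc_eq hdisc'
  have hn : a * c = k ^ 2 - t * k - m := norm_eq_of_disc_eq hdisc' h2k
  have hcard : (reducedForms d).card = Nat.card (ClassGroup (𝓞 K)) := by
    rw [hdt, card_reducedForms_eq_classNumber' bK hb hω hneg', NumberField.classNumber,
      Nat.card_eq_fintype_card]
  have h2le : 2 ≤ Nat.card (ClassGroup (𝓞 K)) := by
    rw [← hcard]
    exact two_le_card_reducedForms_of_twoFormClasses hd hneg h2f
  exact ⟨K, inferInstance, inferInstance, bK, t, m, k, h2, hb, hω, by rw [← hdt]; exact hlt, ha,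
    hn, by linarith, h2le, hcard⟩

/-- `Z_{(a, t − 2k, c)} = Z_{(a, b, c)}` when `t − 2k = −b` (`y ↦ −y`). [folklore] -/
theorem epsteinZeta_intCast_sub_two_mul {a b c t k : ℤ} (htk : t - 2 * k = -b) (s : ℂ) :
    epsteinZeta (a : ℝ) ((t - 2 * k : ℤ) : ℝ) (c : ℝ) s = epsteinZeta (a : ℝ) (b : ℝ) (c : ℝ) s := by
  rw [htk, Int.cast_neg, epsteinZeta_neg_snd]

/-! ## Davenport–Heilbronn I, Theorem 3, for forms -/

/-- **Davenport–Heilbronn I, Theorem 3 (with Titchmarsh's `≫ T` count of §10.25).** Let `a, b, c`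
be integers with `Q = (a, b, c)` positive definite, `d = b² − 4ac` a fundamental discriminant,
`TwoFormClasses d`, and `h(d)` EVEN (`h(d)` = the number of reduced primitive positive definite
forms of discriminant `d`, `BinaryQuadraticForm.classNumber`, `= h_K`). Then "`ζ(s, Q)` has an
infinity of zeros for `σ > 1`", indeed `≥ C·T` of them with `0 < ℑ s ≤ T` for all large `T`: the
conclusion of `DavenportHeilbronn1936b_epstein` for `Q`. Proof: `exists_fieldData`,
`davenportHeilbronn_conclusion_of_even_card` for the form `(a, −b, c)` of the lattice ideal
`(a, ω − k)`, and `Z_{(a,−b,c)} = Z_{(a,b,c)}`. [cite: DavenportHeilbronn1936a, §4 Theorem 3]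
[cite: Titchmarsh1986, §10.25] -/
theorem davenportHeilbronn_epstein_of_even_classNumber (a b c : ℤ) (hQ : IsPosDefForm a b c)
    (hd : IsFundamentalDiscriminant (b ^ 2 - 4 * a * c)) (h2f : TwoFormClasses (b ^ 2 - 4 * a * c))
    (heven : Even (BinaryQuadraticForm.classNumber (b ^ 2 - 4 * a * c))) :
    {s : ℂ | 1 < s.re ∧ epsteinZeta a b c s = 0}.Infinite ∧
      ∃ C : ℝ, 0 < C ∧ ∀ᶠ T : ℝ in atTop,
        C * T ≤ ({s : ℂ | 1 < s.re ∧ 0 < s.im ∧ s.im ≤ T ∧ epsteinZeta a b c s = 0}.ncard : ℝ) := by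
  obtain ⟨K, _, _, bK, t, m, k, h2, hb, hω, hD, ha, hn, htk, -, hcard⟩ := exists_fieldData a b c hQ hd h2f
  have heven' : Even (Nat.card (ClassGroup (𝓞 K))) := by
    rw [← hcard]; exact heven
  have H := davenportHeilbronn_conclusion_of_even_card h2 bK hb hω hD ha hn heven'
  simp only [epsteinZeta_intCast_sub_two_mul htk] at H
  exact H

end DHEpstein

end Literature.Barriers.RiemannHypothesis
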